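import Literature.Computability.Complexity.RandomizingPolynomialsCanon
import Mathlib.LinearAlgebra.Matrix.Block
import HarnessLib

/-!
# Randomizing polynomials IX: canonical form of a general branching-program matrix

Files I–II of the series (`RandomizingPolynomialsMatrix/Canon.lean`) treat the PATH matrix of an
iterated product.  This file proves the Ishai–Kushilevitz canonical-form theorem for the GENERAL
matrix shape of a branching program [Applebaum–Ishai–Kushilevitz 2006, Fact 4.14; Ishai–Kushilevitz
2002, §3]: a square matrix `M` over `F₂` of size `d + 1` with `1` (`= -1`) on the subdiagonal and
`0` below it (`IsBPShape M`; the entries on and above the diagonal are arbitrary — for the matrix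
`L(x)` of a branching program they are the degree-`1` edge labels) factors as

`M = U(M) · C_{δ(M)} · V(M)`            (`eq_shiftU_mul_canon_mul_colV`)

with `U(M)` upper unitriangular (`shiftU M`: `e₀` followed by the first `d` columns of `M`),
`V(M) = 1 + (w in the last column)` a last-column matrix (`colV M`, `w = T⁻¹ c` where `T` is the
upper unitriangular lower-left `d × d` block of `M` and `c` the rest of its last column), and
`C_δ` the canonical matrix of file I with corner value

`δ(M) = M₀,d - ∑ⱼ M₀,ⱼ wⱼ`             (`corner M`; print: `δ = det M` up to sign).

Consequences, exactly as for the path matrix in file II but for every `M` of BP shape: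
* `eq_of_proj_eq_of_isBPShape` — the projection (entries on and above the diagonal) of `A · M · B`,
  `A` unitriangular, `B` last-column, determines `A` and `B` (injectivity on the randomness);
* `corner_eq_of_proj_eq` — it determines `δ(M)` (decoding);
* `exists_proj_eq_of_corner_eq` — if `δ(M) = δ(M')` every randomization of `M` is a randomization
  of `M'` (the range depends only on `δ`): uses the explicit unitriangular inverse `unshiftU M` of
  `shiftU M` (`unshiftU_mul_shiftU`), via "the inverse of a unitriangular matrix is unitriangular"
  (`inv_unitri`, from Mathlib's `blockTriangular_inv_of_blockTriangular`);
* `corner_eq_of_mulVec` — the POTENTIAL characterization used to identify `δ(L(x))` with the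
  function of a branching program without determinants: if `M p = φ e₀` for a vector `p` with last
  coordinate `1`, then `δ(M) = φ` (for `L(x)`, `p` = the vector of path counts to the sink);
* consistency with files I–II: `isBPShape_pathMat`, `corner_pathMat : δ(L(x, ρ)) = ∏ xᵢ + ρ`.

Not here: the matrix of a concrete branching program and its symbolic degree-3 block (next files).

## References

* B. Applebaum, Y. Ishai, E. Kushilevitz, *Cryptography in NC⁰*, SIAM J. Comput. 36 (2006), §4.3,
  Facts 4.13–4.14, Lemma 4.15.
* Y. Ishai, E. Kushilevitz, *Perfect constant-round secure computation via perfect randomizing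
  polynomials*, ICALP 2002, §3; *Randomizing polynomials*, FOCS 2000.
-/

namespace Literature.Computability.Complexity

namespace RandPoly

open Matrix Finset

variable {d : ℕ}

/-! ### The shape of a branching-program matrix -/

/-- **Branching-program shape**: `1` on the subdiagonal and `0` below it (over `F₂`, `1 = -1`);
the entries on and above the diagonal are unconstrained.  The class of matrices `M` of AIK's
Fact 4.14. [cite: ApplebaumIshaiKushilevitz2006, Fact 4.14] -/
def IsBPShape (M : Mat d) : Prop :=
  (∀ i j : Fin (d + 1), i.val = j.val + 1 → M i j = 1) ∧
    ∀ i j : Fin (d + 1), j.val + 1 < i.val → M i j = 0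

/-- The path matrix of files I–II has branching-program shape. [cite: IshaiKushilevitz2002, §3] -/
theorem isBPShape_pathMat (xs : Fin (d + 1) → ZMod 2) (ρ : ZMod 2) : IsBPShape (pathMat xs ρ) := by
  refine ⟨fun i j hij => ?_, fun i j hij => ?_⟩
  · have h1 : i ≠ j := fun h => by rw [h] at hij; omega
    have h2 : ¬ (i = 0 ∧ j = Fin.last d) := fun h => by rw [h.1] at hij; simp at hij
    simp [pathMat, h1, hij, h2]
  · have h1 : i ≠ j := fun h => by rw [h] at hij; omega
    have h2 : i.val ≠ j.val + 1 := by omega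
    have h3 : ¬ (i = 0 ∧ j = Fin.last d) := fun h => by rw [h.1] at hij; simp at hij
    simp [pathMat, h1, h2, h3]

/-- The canonical matrix has branching-program shape. [folklore] -/
theorem isBPShape_canon (δ : ZMod 2) : IsBPShape (canon (d := d) δ) :=
  isBPShape_pathMat 0 δ

/-! ### The blocks of a shape matrix -/

/-- The lower-left `d × d` block `T` (rows `1..d`, columns `0..d-1`): upper unitriangular. [folklore] -/
def lowerT (M : Mat d) : Matrix (Fin d) (Fin d) (ZMod 2) := Matrix.of fun i j => M i.succ j.castSucc

/-- The last column below row `0`. [folklore] -/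
def colC (M : Mat d) : Fin d → ZMod 2 := fun i => M i.succ (Fin.last d)

/-- Row `0` without its last entry. [folklore] -/
def rowA (M : Mat d) : Fin d → ZMod 2 := fun j => M 0 j.castSucc

variable {M : Mat d}

/-- `T` has unit diagonal. [folklore] -/
theorem lowerT_diag (h : IsBPShape M) (i : Fin d) : lowerT M i i = 1 :=
  h.1 _ _ (by simp)

/-- `T` vanishes below the diagonal. [folklore] -/
theorem lowerT_lower (h : IsBPShape M) {i j : Fin d} (hji : j < i) : lowerT M i j = 0 :=
  h.2 _ _ (by rw [Fin.lt_def] at hji; simp; omega)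

/-- `T` is (block) upper triangular. [folklore] -/
theorem blockTriangular_lowerT (h : IsBPShape M) : (lowerT M).BlockTriangular id :=
  fun _ _ hji => lowerT_lower h hji

/-- `det T = 1`. [folklore] -/
theorem det_lowerT (h : IsBPShape M) : (lowerT M).det = 1 := by
  rw [det_of_upperTriangular (blockTriangular_lowerT h)]
  exact Finset.prod_eq_one fun i _ => lowerT_diag h i

/-- `T` is invertible. [folklore] -/
theorem isUnit_det_lowerT (h : IsBPShape M) : IsUnit (lowerT M).det := by
  rw [det_lowerT h]; exact isUnit_one

/-- **The inverse of an upper unitriangular matrix is upper unitriangular.** [folklore] -/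
theorem inv_unitri {T : Matrix (Fin d) (Fin d) (ZMod 2)} (hdiag : ∀ i, T i i = 1)
    (htri : ∀ i j, j < i → T i j = 0) :
    (∀ i, T⁻¹ i i = 1) ∧ ∀ i j, j < i → T⁻¹ i j = 0 := by
  have hbt : T.BlockTriangular id := fun i j hji => htri i j hji
  have hdet : T.det = 1 := by
    rw [det_of_upperTriangular hbt]; exact Finset.prod_eq_one fun i _ => hdiag i
  have hunit : IsUnit T.det := by rw [hdet]; exact isUnit_one
  haveI : Invertible T := Matrix.invertibleOfIsUnitDet T hunit
  have hinv : T⁻¹.BlockTriangular id := Matrix.blockTriangular_inv_of_blockTriangular hbt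
  have htri' : ∀ i j, j < i → T⁻¹ i j = 0 := fun i j hji => hinv hji
  refine ⟨fun i => ?_, htri'⟩
  have h1 := congrFun (congrFun (nonsing_inv_mul T hunit) i) i
  rw [Matrix.mul_apply, Matrix.one_apply_eq, Finset.sum_eq_single i] at h1
  · rwa [hdiag, mul_one] at h1
  · intro j _ hji
    rcases lt_or_gt_of_ne hji with hlt | hlt
    · rw [htri' i j hlt, zero_mul]
    · rw [htri j i hlt, mul_zero]
  · simp

/-! ### The solution `w` of `T w = c` and the corner value `δ(M)` -/

/-- `w = T⁻¹ c`. [cite: ApplebaumIshaiKushilevitz2006, Fact 4.14 (proof)] -/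
noncomputable def solW (M : Mat d) : Fin d → ZMod 2 := (lowerT M)⁻¹ *ᵥ colC M

/-- `T w = c`. [folklore] -/
theorem lowerT_mulVec_solW (h : IsBPShape M) : lowerT M *ᵥ solW M = colC M := by
  rw [solW, mulVec_mulVec, mul_nonsing_inv _ (isUnit_det_lowerT h), one_mulVec]

/-- **The corner value** `δ(M) = M₀,d - ∑ⱼ M₀,ⱼ wⱼ` of the canonical form of `M` (print: the
determinant of `M`, up to the sign `(-1)^d`). [cite: ApplebaumIshaiKushilevitz2006, Fact 4.14 (proof)] -/
noncomputable def corner (M : Mat d) : ZMod 2 := M 0 (Fin.last d) - ∑ j : Fin d, rowA M j * solW M j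

/-! ### The two factors -/

/-- `U(M)`: first column `e₀`, column `j + 1` = column `j` of `M`.  Upper unitriangular for `M` of
BP shape. [cite: ApplebaumIshaiKushilevitz2006, Fact 4.14 (proof)] -/
def shiftU (M : Mat d) : Mat d := Matrix.of fun i j : Fin (d + 1) =>
  if h : j = 0 then (if i = 0 then 1 else 0) else M i (j.pred h).castSucc

/-- `V(M) = 1 + (w in the last column above the diagonal)`. [cite: ApplebaumIshaiKushilevitz2006, Fact 4.14 (proof)] -/
noncomputable def colV (M : Mat d) : Mat d := Matrix.of fun i j : Fin (d + 1) =>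
  (if i = j then 1 else 0) + (if h : j = Fin.last d ∧ i.val < d then solW M ⟨i.val, h.2⟩ else 0)

/-- First column of `U(M)`. [folklore] -/
theorem shiftU_apply_zero (M : Mat d) (i : Fin (d + 1)) : shiftU M i 0 = if i = 0 then 1 else 0 := by
  simp [shiftU]

/-- Later columns of `U(M)`. [folklore] -/
theorem shiftU_apply_succ (M : Mat d) (i : Fin (d + 1)) (j : Fin d) :
    shiftU M i j.succ = M i j.castSucc := by
  simp [shiftU, Fin.succ_ne_zero]

/-- `U(M)` is upper unitriangular. [folklore] -/
theorem shiftU_isUnitri (h : IsBPShape M) : IsUnitri (shiftU M) := by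
  refine ⟨fun i => ?_, fun i j hji => ?_⟩
  · rcases Fin.eq_zero_or_eq_succ i with rfl | ⟨i', rfl⟩
    · rw [shiftU_apply_zero, if_pos rfl]
    · rw [shiftU_apply_succ]; exact h.1 _ _ (by simp)
  · rcases Fin.eq_zero_or_eq_succ j with rfl | ⟨j', rfl⟩
    · rw [shiftU_apply_zero, if_neg (ne_of_gt hji)]
    · rw [shiftU_apply_succ]
      exact h.2 _ _ (by rw [Fin.lt_def] at hji; simp at hji ⊢; omega)

/-- `V(M)` is a last-column matrix. [folklore] -/
theorem colV_isLastCol (M : Mat d) : IsLastCol (colV M) := by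
  refine ⟨fun i => ?_, fun i j hij hj => ?_⟩
  · simp only [colV, of_apply, if_true]
    split_ifs with h
    · obtain ⟨h1, h2⟩ := h
      rw [h1, Fin.val_last] at h2
      exact absurd h2 (lt_irrefl d)
    · rw [add_zero]
  · simp only [colV, of_apply, if_neg hij, zero_add]
    rw [dif_neg (fun h => hj h.1)]

/-- The last column of `V(M)` above the diagonal is `w`. [folklore] -/
theorem colV_apply_castSucc_last (M : Mat d) (l : Fin d) :
    colV M l.castSucc (Fin.last d) = solW M l := by
  rw [colV, of_apply, if_neg (Fin.castSucc_lt_last l).ne, dif_pos ⟨rfl, by simp⟩, zero_add]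
  congr 1

/-! ### The canonical form -/

/-- Right multiplication by the canonical matrix, last column. [folklore] -/
theorem mul_canon_apply_last (X : Mat d) (δ : ZMod 2) (i : Fin (d + 1)) :
    (X * canon (d := d) δ) i (Fin.last d) = X i 0 * δ := by
  rw [Matrix.mul_apply, Finset.sum_eq_single (0 : Fin (d + 1))]
  · rw [canon_apply]; simp
  · intro j _ hj
    rw [canon_apply, if_neg (by have := j.isLt; simp; omega), if_neg (fun h => hj h.1), add_zero,
      mul_zero]
  · simp

/-- `U(M) · C_δ`: the first `d` columns of `M`, then `δ e₀`. [folklore] -/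
theorem shiftU_mul_canon_apply (M : Mat d) (δ : ZMod 2) (i k : Fin (d + 1)) :
    (shiftU M * canon (d := d) δ) i k = if k = Fin.last d then (if i = 0 then δ else 0) else M i k := by
  split_ifs with hk hi
  · rw [hk, mul_canon_apply_last, shiftU_apply_zero, if_pos hi, one_mul]
  · rw [hk, mul_canon_apply_last, shiftU_apply_zero, if_neg hi, zero_mul]
  · rw [mul_canon_apply_ne _ _ _ hk, shiftU, of_apply,
      dif_neg (fun h => by have := congrArg Fin.val h; simp at this)]
    congr 1

/-- **Canonical form of a branching-program matrix** (AIK Fact 4.14, constructive form):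
`M = U(M) · C_{δ(M)} · V(M)` with `U(M)` upper unitriangular and `V(M)` last-column.
[cite: ApplebaumIshaiKushilevitz2006, Fact 4.14] -/
theorem eq_shiftU_mul_canon_mul_colV (h : IsBPShape M) :
    M = shiftU M * canon (corner M) * colV M := by
  ext i k
  rw [mul_lastCol_apply (colV_isLastCol M)]
  by_cases hk : k = Fin.last d
  · subst hk
    rw [if_pos rfl, Fin.sum_univ_castSucc, (colV_isLastCol M).1 (Fin.last d), mul_one,
      shiftU_mul_canon_apply, if_pos rfl]
    have hcs : ∀ l : Fin d,
        (shiftU M * canon (d := d) (corner M)) i l.castSucc * colV M l.castSucc (Fin.last d) =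
          M i l.castSucc * solW M l := fun l => by
      rw [shiftU_mul_canon_apply, if_neg (Fin.castSucc_lt_last l).ne, colV_apply_castSucc_last]
    rw [Finset.sum_congr rfl fun l _ => hcs l]
    rcases Fin.eq_zero_or_eq_succ i with rfl | ⟨i', rfl⟩
    · rw [if_pos rfl, corner]
      unfold rowA
      ring
    · rw [if_neg (Fin.succ_ne_zero i'), add_zero]
      have := congrFun (lowerT_mulVec_solW h) i'
      simp only [Matrix.mulVec, dotProduct, lowerT, of_apply, colC] at this
      exact this.symm
  · rw [if_neg hk, shiftU_mul_canon_apply, if_neg hk]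

/-- Consistency with file II: the corner value of the path matrix is the value of the path,
`δ(L(x, ρ)) = x₀ ⋯ x_d + ρ`. [cite: IshaiKushilevitz2002, §3] -/
theorem corner_pathMat (xs : Fin (d + 1) → ZMod 2) (ρ : ZMod 2) :
    corner (pathMat xs ρ) = pathVal xs ρ := by
  have h1 := eq_shiftU_mul_canon_mul_colV (isBPShape_pathMat xs ρ)
  have h2 := pathMat_eq xs ρ
  exact (eq_of_proj_canon_eq (shiftU_isUnitri (isBPShape_pathMat xs ρ)) (elimAinv_isUnitri xs)
    (colV_isLastCol _) (elimB_isLastCol xs) (fun i k _ => by rw [← h1, ← h2])).2.2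

/-! ### The unitriangular inverse of `U(M)` -/

/-- `U(M)⁻¹ = [[1, -a T⁻¹], [0, T⁻¹]]` (`a` = row `0` of `M` without its last entry).
[cite: ApplebaumIshaiKushilevitz2006, Fact 4.14 (proof)] -/
noncomputable def unshiftU (M : Mat d) : Mat d := Matrix.of fun i j : Fin (d + 1) =>
  if hi : i = 0 then
    (if hj : j = 0 then 1 else -∑ l : Fin d, rowA M l * (lowerT M)⁻¹ l (j.pred hj))
  else (if hj : j = 0 then 0 else (lowerT M)⁻¹ (i.pred hi) (j.pred hj))

/-- Entries of `U(M)⁻¹`, row `0`. [folklore] -/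
theorem unshiftU_zero_zero (M : Mat d) : unshiftU M 0 0 = 1 := by simp [unshiftU]

/-- Entries of `U(M)⁻¹`, row `0`, later columns. [folklore] -/
theorem unshiftU_zero_succ (M : Mat d) (j : Fin d) :
    unshiftU M 0 j.succ = -∑ l : Fin d, rowA M l * (lowerT M)⁻¹ l j := by
  simp [unshiftU, Fin.succ_ne_zero]

/-- Entries of `U(M)⁻¹`, later rows, column `0`. [folklore] -/
theorem unshiftU_succ_zero (M : Mat d) (i : Fin d) : unshiftU M i.succ 0 = 0 := by
  simp [unshiftU, Fin.succ_ne_zero]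

/-- Entries of `U(M)⁻¹`, the `T⁻¹` block. [folklore] -/
theorem unshiftU_succ_succ (M : Mat d) (i j : Fin d) :
    unshiftU M i.succ j.succ = (lowerT M)⁻¹ i j := by
  simp [unshiftU, Fin.succ_ne_zero]

/-- `U(M)⁻¹ · U(M) = 1`. [cite: ApplebaumIshaiKushilevitz2006, Fact 4.14 (proof)] -/
theorem unshiftU_mul_shiftU (h : IsBPShape M) : unshiftU M * shiftU M = 1 := by
  have hTT : (lowerT M)⁻¹ * lowerT M = 1 := nonsing_inv_mul _ (isUnit_det_lowerT h)
  ext i k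
  rw [Matrix.mul_apply, Fin.sum_univ_succ]
  rcases Fin.eq_zero_or_eq_succ k with rfl | ⟨k', rfl⟩
  · -- column 0
    rw [shiftU_apply_zero, if_pos rfl, mul_one, Finset.sum_eq_zero (fun x _ => by
      rw [shiftU_apply_zero, if_neg (Fin.succ_ne_zero x), mul_zero]), add_zero, Matrix.one_apply]
    rcases Fin.eq_zero_or_eq_succ i with rfl | ⟨i', rfl⟩
    · rw [unshiftU_zero_zero, if_pos rfl]
    · rw [unshiftU_succ_zero, if_neg (Fin.succ_ne_zero i')]
  · -- later columns
    rw [shiftU_apply_succ, Finset.sum_congr rfl fun x _ => by rw [shiftU_apply_succ]]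
    rcases Fin.eq_zero_or_eq_succ i with rfl | ⟨i', rfl⟩
    · rw [unshiftU_zero_zero, one_mul, Matrix.one_apply, if_neg (fun h => Fin.succ_ne_zero k' h.symm),
        Finset.sum_congr rfl fun x _ => by rw [unshiftU_zero_succ]]
      have hrow : ∀ l : Fin d, ∑ x : Fin d, rowA M l * (lowerT M)⁻¹ l x * M x.succ k'.castSucc =
          rowA M l * ((lowerT M)⁻¹ * lowerT M) l k' := fun l => by
        rw [Matrix.mul_apply, Finset.mul_sum]
        refine Finset.sum_congr rfl fun x _ => ?_
        rw [lowerT, of_apply, mul_assoc]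
      simp only [neg_mul, Finset.sum_neg_distrib, Finset.sum_mul]
      rw [Finset.sum_comm, Finset.sum_congr rfl fun l _ => hrow l, hTT]
      simp only [Matrix.one_apply, mul_ite, mul_one, mul_zero, Finset.sum_ite_eq', Finset.mem_univ,
        if_true]
      rw [rowA, add_neg_cancel]
    · rw [unshiftU_succ_zero, zero_mul, zero_add, Matrix.one_apply,
        Finset.sum_congr rfl fun x _ => by rw [unshiftU_succ_succ]]
      have : ∑ x : Fin d, (lowerT M)⁻¹ i' x * M x.succ k'.castSucc = ((lowerT M)⁻¹ * lowerT M) i' k' := by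
        rw [Matrix.mul_apply]
        refine Finset.sum_congr rfl fun x _ => ?_
        rw [lowerT, of_apply]
      rw [this, hTT, Matrix.one_apply]
      simp [Fin.succ_inj]

/-- `U(M)⁻¹` is upper unitriangular. [folklore] -/
theorem unshiftU_isUnitri (h : IsBPShape M) : IsUnitri (unshiftU M) := by
  obtain ⟨hdiag, htri⟩ := inv_unitri (T := lowerT M) (lowerT_diag h) (fun i j hji => lowerT_lower h hji)
  refine ⟨fun i => ?_, fun i j hji => ?_⟩
  · rcases Fin.eq_zero_or_eq_succ i with rfl | ⟨i', rfl⟩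
    · exact unshiftU_zero_zero M
    · rw [unshiftU_succ_succ]; exact hdiag i'
  · rcases Fin.eq_zero_or_eq_succ i with rfl | ⟨i', rfl⟩
    · exact absurd hji (Fin.not_lt_zero j)
    · rcases Fin.eq_zero_or_eq_succ j with rfl | ⟨j', rfl⟩
      · exact unshiftU_succ_zero M i'
      · rw [unshiftU_succ_succ]
        exact htri i' j' (Fin.succ_lt_succ_iff.1 hji)

/-! ### The three properties of the randomization `(A, B) ↦ proj (A · M · B)` -/

/-- Uniqueness transported along canonical forms (auxiliary, canonical data as hypotheses). [folklore] -/
theorem eq_of_proj_eq_aux {M M' U V U' V' : Mat d} {δ δ' : ZMod 2}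
    (hcan : M = U * canon δ * V) (hcan' : M' = U' * canon δ' * V')
    (hU : IsUnitri U) (hV : IsLastCol V) (hU' : IsUnitri U') (hV' : IsLastCol V')
    {A A' B B' : Mat d} (hA : IsUnitri A) (hA' : IsUnitri A') (hB : IsLastCol B) (hB' : IsLastCol B')
    (h : ∀ i k : Fin (d + 1), i ≤ k → (A * M * B) i k = (A' * M' * B') i k) :
    A * U = A' * U' ∧ V * B = V' * B' ∧ δ = δ' := by
  subst hcan hcan'
  have key : ∀ (A U V B : Mat d) (δ : ZMod 2), A * (U * canon δ * V) * B = (A * U) * canon δ * (V * B) :=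
    fun A U V B δ => by simp only [Matrix.mul_assoc]
  simp only [key] at h
  exact eq_of_proj_canon_eq (hA.mul hU) (hA'.mul hU') (hV.mul hB) (hV'.mul hB') h

/-- **Injectivity**: for a fixed matrix of BP shape, the projection of `A · M · B` determines the
randomizers. [cite: ApplebaumIshaiKushilevitz2006, Lemma 4.15] -/
theorem eq_of_proj_eq_of_isBPShape (hM : IsBPShape M) {A A' B B' : Mat d}
    (hA : IsUnitri A) (hA' : IsUnitri A') (hB : IsLastCol B) (hB' : IsLastCol B')
    (h : ∀ i k : Fin (d + 1), i ≤ k → (A * M * B) i k = (A' * M * B') i k) :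
    A = A' ∧ B = B' := by
  obtain ⟨h1, h2, -⟩ := eq_of_proj_eq_aux (eq_shiftU_mul_canon_mul_colV hM)
    (eq_shiftU_mul_canon_mul_colV hM) (shiftU_isUnitri hM) (colV_isLastCol M) (shiftU_isUnitri hM)
    (colV_isLastCol M) hA hA' hB hB' h
  exact ⟨(shiftU_isUnitri hM).isUnit.mul_right_cancel h1,
    (colV_isLastCol M).isUnitri.isUnit.mul_left_cancel h2⟩

/-- **Decodability**: the projection of `A · M · B` determines the corner value `δ(M)`.
[cite: ApplebaumIshaiKushilevitz2006, Lemma 4.15] -/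
theorem corner_eq_of_proj_eq {M M' : Mat d} (hM : IsBPShape M) (hM' : IsBPShape M')
    {A A' B B' : Mat d} (hA : IsUnitri A) (hA' : IsUnitri A') (hB : IsLastCol B) (hB' : IsLastCol B')
    (h : ∀ i k : Fin (d + 1), i ≤ k → (A * M * B) i k = (A' * M' * B') i k) :
    corner M = corner M' :=
  (eq_of_proj_eq_aux (eq_shiftU_mul_canon_mul_colV hM) (eq_shiftU_mul_canon_mul_colV hM')
    (shiftU_isUnitri hM) (colV_isLastCol M) (shiftU_isUnitri hM') (colV_isLastCol M')
    hA hA' hB hB' h).2.2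

/-- Range transported along canonical forms (auxiliary, canonical data as hypotheses). [folklore] -/
theorem exists_proj_eq_aux {M M' U V U' V' P' : Mat d} {δ : ZMod 2}
    (hcan : M = U * canon δ * V) (hcan' : M' = U' * canon δ * V')
    (hU : IsUnitri U) (hV : IsLastCol V) (hV' : IsLastCol V')
    (hP' : IsUnitri P') (e : P' * U' = 1) {A B : Mat d} (hA : IsUnitri A) (hB : IsLastCol B) :
    ∃ A'' B'' : Mat d, IsUnitri A'' ∧ IsLastCol B'' ∧ A'' * M' * B'' = A * M * B := by
  subst hcan hcan'
  refine ⟨A * U * P', V' * V * B, (hA.mul hU).mul hP', (hV'.mul hV).mul hB, ?_⟩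
  have e' : U' * P' = 1 := mul_eq_one_comm_of_isUnit hP'.isUnit e
  simp only [Matrix.mul_assoc]
  rw [← Matrix.mul_assoc P' U' _, e, Matrix.one_mul, ← Matrix.mul_assoc V' V' _, hV'.mul_self,
    Matrix.one_mul]

/-- **Range**: if two matrices of BP shape have the same corner value, every randomization of the
first is a randomization of the second. [cite: ApplebaumIshaiKushilevitz2006, Lemma 4.15] -/
theorem exists_proj_eq_of_corner_eq {M M' : Mat d} (hM : IsBPShape M) (hM' : IsBPShape M')
    (hc : corner M = corner M') {A B : Mat d} (hA : IsUnitri A) (hB : IsLastCol B) :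
    ∃ A' B' : Mat d, IsUnitri A' ∧ IsLastCol B' ∧ A' * M' * B' = A * M * B := by
  have hcan' : M' = shiftU M' * canon (corner M) * colV M' := by
    rw [hc]; exact eq_shiftU_mul_canon_mul_colV hM'
  exact exists_proj_eq_aux (eq_shiftU_mul_canon_mul_colV hM) hcan' (shiftU_isUnitri hM)
    (colV_isLastCol M) (colV_isLastCol M') (unshiftU_isUnitri hM') (unshiftU_mul_shiftU hM') hA hB

/-! ### The corner value from a potential -/

/-- **Potential characterization of the corner value**: if `M p = φ · e₀` for a vector `p` with
last coordinate `1`, then `δ(M) = φ`.  (For the matrix `L(x)` of a branching program, `p` is the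
vector of numbers of paths to the sink and `φ` the number of source–sink paths, AIK Fact 4.13.)
[cite: ApplebaumIshaiKushilevitz2006, Fact 4.13] -/
theorem corner_eq_of_mulVec (h : IsBPShape M) {p : Fin (d + 1) → ZMod 2}
    (hp : p (Fin.last d) = 1) {φ : ZMod 2} (h0 : (M *ᵥ p) 0 = φ)
    (hsucc : ∀ i : Fin d, (M *ᵥ p) i.succ = 0) : corner M = φ := by
  set p' : Fin d → ZMod 2 := fun j => p j.castSucc with hp'
  have h1 : lowerT M *ᵥ p' = -colC M := by
    funext i
    have hi := hsucc i
    simp only [Matrix.mulVec, dotProduct, Fin.sum_univ_castSucc, hp, mul_one] at hi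
    simp only [Matrix.mulVec, dotProduct, lowerT, of_apply, colC, Pi.neg_apply, hp']
    exact eq_neg_of_add_eq_zero_left hi
  have h2 : p' = -solW M := by
    have hT := isUnit_det_lowerT h
    calc p' = (lowerT M)⁻¹ *ᵥ (lowerT M *ᵥ p') := by
          rw [mulVec_mulVec, nonsing_inv_mul _ hT, one_mulVec]
      _ = -solW M := by rw [h1, Matrix.mulVec_neg, solW]
  have h3 := h0
  simp only [Matrix.mulVec, dotProduct, Fin.sum_univ_castSucc, hp, mul_one] at h3
  rw [← h3, corner]
  have h4 : ∀ j : Fin d, p j.castSucc = -solW M j := fun j => by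
    have := congrFun h2 j
    simpa [hp'] using this
  simp only [h4, rowA, mul_neg, Finset.sum_neg_distrib]
  ring

end RandPoly

end Literature.Computability.Complexity
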